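import Literature.NumberTheory.EllipticCurves.BSDSelmerCMPConverse
import Literature.NumberTheory.EllipticCurves.Rank1Residual.Predicates
import Literature.NumberTheory.EllipticCurves.ComplexMultiplication
import Literature.NumberTheory.EllipticCurves.BSDAnalyticRank
import Literature.NumberTheory.EllipticCurves.MordellCurveThreeDescent
import HarnessLib

/-!
# Kříž 2020 (arXiv:2002.04767): the rank-one `p`-converse at a prime RAMIFIED in the CM field, and its two named special cases — the congruent number family at `p = 2` and the cubic-twist (Sylvester) family at `p = 3`

HONEST FRAMING (cell `bsd-cn100`, `run/shared/lean/pub/bsd-cn100/`). This file vendors ONE CLAIMED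
statement of an UNREFEREED PREPRINT as a named fact (`def … : Prop`; nothing is asserted, D-0014),
plus its two special cases in the vocabulary of the tree, so that every downstream theorem carries
"Kříž's rank-one `2`-converse for `y² = x³ − n²x`" as ONE NAMED HYPOTHESIS
(`rankOne_twoConverse_congruentNumber`) and nothing else from the preprint. The consumers
("`r_an = r_MW` for `100 %` of the quadratic twists of `y² = x³ − x`", "`100 %` of the squarefree
`n ≡ 5, 6, 7 (mod 8)` are congruent numbers", Sylvester's conjecture for primes `≡ 4, 7, 8 (mod 9)`)
live in the sibling proof files `Kriz2020/CongruentNumberDensityOneProofs.lean` and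
`Kriz2020/SylvesterProofs.lean`; they combine this hypothesis with inputs that are already named
facts of the tree, of the following status (precised 2026-08-25 after the cell referee's scoring,
`run/shared/lean/pub/bsd-cn100/STATEMENT-SCORES.md`, File 3 §S3):
* the `2^∞`-Selmer distribution in the twist family, in TWO interchangeable forms —
  `smith_selmerCorank_density` (A. Smith, arXiv:2503.17619 (2025), Thm. 1.1, stated for every
  `E/ℚ`; itself an UNREFEREED preprint as of 2026-08) and, for the only instance the congruent
  number consumers use (`E : y² = x³ − x`), the REFEREED route `smith2022_selmerCorank_distribution`
  (A. Smith, *The distribution of `ℓ^∞`-Selmer groups in degree `ℓ` twist families I*,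
  J. Amer. Math. Soc. 39 (2026), doi:10.1090/jams/1062 = arXiv:2207.05674, Thm. 1.2 under its
  Assumption 1.1, whose branch (3) — `E(ℚ)[2] ≅ (ℤ/2)²`, no cyclic `4`-isogeny over `ℚ` — is PROVED
  for `y² = x³ − x` in the tree, `smithCaseI_example` with `smi22aAssumption_of_smithCaseI`;
  cf. Burungale–Tian, Ann. of Math. 203 (2026), Thm. 3.3); the sibling proof file carries both
  forms (`…_of_converse` with `hS`, `…_of_converse_of_smith2022` with `h22`);
* Burungale–Tian's rank-zero `p`-converse for CM curves, Ann. of Math. 203 (2026), Thm. 1.1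
  (refereed) = `burungaleTian_analyticRank_eq_zero_of_selmerCorank_eq_zero_of_hasCM`;
* Gross–Zagier–Kolyvagin (refereed) = `rank_eq_analyticRank_of_analyticRank_le_one`; Modularity
  (Wiles, Taylor–Wiles, BCDT; refereed) = `ModularForms.exists_isNewformOf`.
So, on the refereed route, the statements of THIS file are the only unrefereed binders downstream.

## Citation header (read by this seat from the sources named)

* Author: Daniel Kriz. Title: *Supersingular main conjectures, Sylvester's conjecture and
  Goldfeld's conjecture*. arXiv:2002.04767 [math.NT]; v1 12 Feb 2020 (70 pp.), v2 26 Jul 2021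
  ("some corrections"; the abstract from v2 on restricts to `p` RAMIFIED in `K`, v1 claimed "inert
  or ramified"), v3 14 Sep 2021, v4 22 Jun 2022, v5 19 Oct 2022 (214 pp.). Bib key `Kriz2020`.
* STATUS (2026-08-25): PREPRINT, NOT REFEREED, no journal reference and no DOI on the arXiv
  listing. The cell's two independent adversarial reads of v1 (`GAP-LEDGER-read1.md`: eight entries
  on §3, among them an internal inconsistency in the canonical-coordinate identification (57) on
  which the `O_{L_p}`-integrality of the measure of Thm. 3.2 rests, and a linear-algebra step that
  fails exactly at ramified `p`; `GAP-LEDGER-read2.md`: nineteen entries on §§4–8, two rated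
  fatal-unless-repaired) conclude that v1 does not establish the claim as written; v2–v5 replace
  the architecture of v1 (periods `q_dR` on infinite-level Shimura curves; v5 §1.2, Step (2).1,
  SP_v5.tex l. 402, itself notes that in the supersingular setting "a natural coordinate in the
  structure sheaf of the moduli space does not exist") and are under two further
  independent reads by the cell (ledgers `GAP-LEDGER-read1-v5.md`, `GAP-LEDGER-read2-v5.md` when
  frozen; adjudication `VERDICT.md`). A second, independent claimed proof of the same converse —
  Fan–Wan, arXiv:2304.09806v2 (2026), Thm. 1.1 / Thm. 6.9, anticyclotomic `±`-Iwasawa theory — is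
  likewise unrefereed, with `p = 2` inputs not in print. Expert print 2022–2026 states the ramified
  rank-one `2`- or `3`-converse as OPEN (Tian, Proc. ICM 2022, Conj. B2; Koymans–Smith 2024 after
  Cor. 1.8; Burungale–Tian, Ann. of Math. 203 (2026), p. 2). CONSEQUENTLY THE STATEMENTS BELOW ARE
  HYPOTHESES: they are never
  discharged in the tree, every consumer names them as binders, and a refutation of any of them
  would be a theorem about Selmer coranks and `L`-functions, not about this file.
* Held texts: v1 = lit store `paper:arxiv-2002.04767` (70 text chunks; §8: Thm. 8.5 = rank-one
  converse, Cor. 8.6 = Sylvester, Cor. 8.9 = congruent numbers / Goldfeld); v5 = the arXiv e-print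
  source `SP_v5.tex` (11 827 lines, `\newtheorem{theorem}[section]`, one shared counter) held at
  `run/shared/lean/pub/bsd-cn100/kriz-v5/`. Theorem numbers below are those of v5, computed from
  the source; v1 numbers in brackets.
* Verbatim, v5 Theorem 10.13 (`\label{BSDrank1theorem}`, SP_v5.tex l. 10938) [v1 Thm. 8.5 with
  "inert or ramified"]:

> **Theorem 10.13 (Rank 1 `p`-Converse Theorem).** Let `E/ℚ` be an elliptic curve with CM by
> `𝒪_K` and suppose `p` is ramified in `K`. Then
> `r_p(E/ℚ) := corank_{ℤ_p} Sel_{p^∞}(E/ℚ) = 1 ⟹ r_an(E/ℚ) = r_alg(E/ℚ) = 1` and `#Ш(E/ℚ) < ∞`.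

* Verbatim, v5 Theorem 10.17 (2) (`\label{congruentnumberthm}`, l. 11009) [v1 Cor. 8.9]:

> Let `E^d : y² = x³ − d²x`. If `r_2(E^d/ℚ) ≤ 1`, then `r_an(E^d/ℚ) = r_alg(E^d/ℚ) = r_2(E^d/ℚ)`
> and `#Ш(E^d/ℚ) < ∞`. In particular, if `r_2(E^d/ℚ) = 0` then `|d|` is not a congruent number
> and if `r_2(E^d/ℚ) = 1` then `|d|` is a congruent number.

  with proof (l. 11025): "For the congruent number family `E^d : y² = x³ − d²x`, which has CM by
  `ℤ[i]`, if `r_2(E^d/ℚ) ≤ 1` then (the display) immediately follows from Theorems 9.23 and 10.13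
  with `p = 2` and `K = ℚ(i)`."
* Verbatim, v5 Theorem 10.14 (`\label{Sylvesterthm}`, l. 10956) [v1 Cor. 8.6], for
  `E_d : x³ + y³ = d`: "Suppose `r_3(E_d/ℚ) ≤ 1`. Then `r_an(E_d/ℚ) = r_alg(E_d/ℚ) = r_3(E_d/ℚ)`
  and `#Ш(E_d/ℚ) < ∞`", with proof (l. 10971): "Note that `E_d` has CM by `ℤ[√−3]` [sic; the
  maximal order `ℤ[(1+√−3)/2]`, `j = 0`]. Now since `r_3(E_d/ℚ) ≤ 1`, (the display) follows
  immediately from Theorems 9.23 and 10.13 with `p = 3` and `K = ℚ(√−3)`."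

## Transcription (word for word → tree vocabulary)

1. "`E/ℚ` an elliptic curve with CM by `𝒪_K`" — `W : WeierstrassCurve ℚ`, `[W.IsElliptic]`, and
   `W.j ∈ maximalCMJInvariants` (`ComplexMultiplication.lean`: the nine `j`-invariants of CM by a
   MAXIMAL imaginary quadratic order, Silverman, *Advanced Topics*, App. A §3; CM by `𝒪_K` is a
   property of `j(E)` alone).
2. "`p` is ramified in `K`" — `Rank1Residual.CMRamified W p : (p : ℤ) ∣ d_K` with
   `d_K = Rank1Residual.cmFieldDiscrOfJ W.j` (`Rank1Residual/Predicates.lean`, the predicate of the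
   FULL-BSD rank-`≤ 1` residual class X12 "`p` ramified in `K`"; Cox, Prop. 5.16).
3. "`r_p(E/ℚ) = corank_{ℤ_p} Sel_{p^∞}(E/ℚ)`" — `W.selmerCorank p` (`Selmer.lean`, Greenberg 1999);
   "`r_an(E/ℚ)`" — `W.analyticRank` (`AnalyticRank.lean`).
4. Conclusion. Only "`r_an(E/ℚ) = 1`" is transcribed. The printed "`r_alg = 1` and `#Ш < ∞`" is,
   in the paper as in the tree, the Gross–Zagier–Kolyvagin consequence of `r_an = 1` (named fact
   `rank_eq_analyticRank_of_analyticRank_le_one`, bsd.S17); omitting it makes the hypothesis WEAKER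
   than the printed claim, never stronger.
5. Special cases. `congruentNumberCurve n = ⟨0, 0, 0, −n², 0⟩` (`BSDAnalyticRank.lean`) is the
   printed `E^d`, `d = ±n` (`j = 1728`, `d_K = −4`, `2 ∣ −4`); `mordellCurve D = ⟨0, 0, 0, 0, D⟩`
   (`MordellCurveThreeDescent.lean`), `D ≠ 0`, is every `j = 0` curve over `ℚ` (`d_K = −3`,
   `3 ∣ −3`), among them the Weierstrass model `y² = x³ − 432 d²` of `x³ + y³ = d`. Both special
   cases are literally instances of item 1–4 (sibling proof file:
   `rankOne_twoConverse_congruentNumber_of_cmRamified`, `rankOne_threeConverse_mordellCurve_of_cmRamified`).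

Nothing in this file is used by the tree except as an explicit hypothesis `(hK : …)`.
-/

noncomputable section

open scoped Classical

open WeierstrassCurve

namespace Literature.NumberTheory.EllipticCurves

/-- **Kříž, arXiv:2002.04767v5, Theorem 10.13 (Rank 1 `p`-Converse Theorem) — CLAIMED, UNREFEREED;
a hypothesis of the tree, never discharged** (see the module docstring for the status and the
cell's gap ledgers). "Let `E/ℚ` be an elliptic curve with CM by `𝒪_K` and suppose `p` is ramified
in `K`. Then `corank_{ℤ_p} Sel_{p^∞}(E/ℚ) = 1 ⟹ r_an(E/ℚ) = r_alg(E/ℚ) = 1` and `#Ш(E/ℚ) < ∞`."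
Transcribed: `j(W) ∈ maximalCMJInvariants` (CM by the maximal order), `p ∣ d_K`
(`Rank1Residual.CMRamified`), `W.selmerCorank p = 1 → W.analyticRank = 1` (the clauses `r_alg = 1`,
`#Ш < ∞` are then bsd.S17). [cite: Kriz2020, Thm. 10.13 of v5 (= Thm. 8.5 of v1, ramified case)] -/
def kriz_analyticRank_eq_one_of_selmerCorank_eq_one_of_cmRamified : Prop :=
  ∀ (W : WeierstrassCurve ℚ) [W.IsElliptic] (_hj : W.j ∈ maximalCMJInvariants) (p : ℕ)
    [Fact p.Prime] (_hp : Rank1Residual.CMRamified W p) (_h : W.selmerCorank p = 1),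
    W.analyticRank = 1

/-- **The rank-one `2`-converse for the congruent number family — Kříž, arXiv:2002.04767v5,
Theorem 10.17 (2), second clause, CLAIMED, UNREFEREED; THE named hypothesis of the cell `bsd-cn100`.**
"Let `E^d : y² = x³ − d²x`. If `r_2(E^d/ℚ) ≤ 1`, then `r_an(E^d/ℚ) = r_alg(E^d/ℚ) = r_2(E^d/ℚ)` …
if `r_2(E^d/ℚ) = 1` then `|d|` is a congruent number" — the case `r_2 = 1`, read on the tree's model
`congruentNumberCurve n : y² = x³ − n²x` (`n = |d| ≠ 0`): `corank_{ℤ_2} Sel_{2^∞}(E_n/ℚ) = 1 ⟹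
ord_{s=1} L(E_n, s) = 1`. It is the instance `p = 2`, `K = ℚ(i)` (`j = 1728`, `2 ∣ d_K = −4`) of
`kriz_analyticRank_eq_one_of_selmerCorank_eq_one_of_cmRamified` (sibling proof file). The case
`r_2 = 0` of the printed clause is NOT part of this hypothesis: it is the published rank-zero
converse of Burungale–Tian (`burungaleTian_analyticRank_eq_zero_of_selmerCorank_eq_zero_of_hasCM`).
[cite: Kriz2020, Thm. 10.17 (2) of v5 (= Cor. 8.9 of v1)] -/
def rankOne_twoConverse_congruentNumber : Prop :=
  ∀ ⦃n : ℕ⦄, n ≠ 0 → (congruentNumberCurve n).selmerCorank 2 = 1 →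
    (congruentNumberCurve n).analyticRank = 1

/-- **The rank-one `3`-converse for the `j = 0` curves `y² = x³ + D` — Kříž, arXiv:2002.04767v5,
Theorem 10.14, rank-one clause, CLAIMED, UNREFEREED; the named hypothesis of the Sylvester
companion.** "(`E_d : x³ + y³ = d`.) Suppose `r_3(E_d/ℚ) ≤ 1`. Then `r_an(E_d/ℚ) = r_alg(E_d/ℚ) =
r_3(E_d/ℚ)`", proved in the source as the instance `p = 3`, `K = ℚ(√−3)` of Theorem 10.13, which
applies verbatim to every elliptic curve over `ℚ` with `j = 0`, i.e. to every
`mordellCurve D : y² = x³ + D`, `D ∈ ℚ^×` (CM by `ℤ[(1+√−3)/2]`, `3 ∣ d_K = −3`); the Weierstrass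
model of `x³ + y³ = d` is `mordellCurve (−432 d²)`. Transcribed, case `r_3 = 1`:
`corank_{ℤ_3} Sel_{3^∞}(E_D/ℚ) = 1 ⟹ ord_{s=1} L(E_D, s) = 1`.
[cite: Kriz2020, Thm. 10.14 with Thm. 10.13 at p = 3 (v5; = Cor. 8.6 of v1)] -/
def rankOne_threeConverse_mordellCurve : Prop :=
  ∀ ⦃D : ℚ⦄, D ≠ 0 → (mordellCurve D).selmerCorank 3 = 1 → (mordellCurve D).analyticRank = 1

end Literature.NumberTheory.EllipticCurves

end
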